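import Literature.MathematicalPhysics.KineticTheory.HierarchyDuhamelSeries
import Literature.MathematicalPhysics.KineticTheory.HierarchyEnergyTruncation
import Literature.MathematicalPhysics.KineticTheory.HierarchyTimeSeparationBlocks
import Literature.Analysis.FluidPDE.HardSphereFlowRegular
import Literature.Analysis.FluidPDE.LiouvilleBBGKY
import Literature.Analysis.FluidPDE.BoltzmannGradLimitProofs
import HarnessLib

/-!
# The BBGKY hierarchy of the hard-sphere system on the torus as a `HierarchyModel`
(Bodineau–Gallagher–Saint-Raymond, Invent. Math. 203 (2016) = arXiv:1305.3397v2, §3.1 (the BBGKY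
hierarchy, its collision operator written "in terms of pre-collisional configurations" thanks to
the trace condition `f_N(t, Z_s) = f_N(t, Z_s^*)` on the outgoing boundary, the iterated Duhamel
formula and Remark 3.1), p. 9; §4.3–4.4; trunk T-KINETIC, topic MathematicalPhysics/KineticTheory;
layer "A1-model" of the bottom-up plan towards fact (c) `bodineau_gallagher_saintRaymond_linear`
recorded in `TaggedSphereLinearBoltzmann`.)

The abstract pruning machinery (N3 `HierarchyContinuityEstimates`, N4a `HierarchyDuhamelBlocks`,
N4b `HierarchyPruningEstimates`, `HierarchyDuhamelSeries`) acts on a `Kinetic.HierarchyModel`: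
transports by jointly measurable energy-preserving maps forming groups on the whole phase space,
and collision operators satisfying BGSR (4.11). This file builds THE instance for `N` hard spheres
of diameter `ε` on `T^d` (`0 < ε < 1/2`):

* transports: the regularised Alexander flows `Alexander.regFlow` of every particle number
  (`HardSphereFlowRegular`: groups everywhere, jointly measurable, energy-preserving, equal to the
  hard-sphere flow on its conull good set and the identity off it);
* collision operator `Kinetic.outBbgkyOp G ε N s`: the BBGKY operator `C_{s,s+1}` of the tree
  (`Kinetic.bbgkyOp`, GST 2013 (4.3.5)–(4.3.6), prefactor `(N - s) ε^{d-1}`) with its argument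
  read, in the `i`-th term, at the *outgoing* (post-collisional) representative
  `collidePair i (s+1)` of the contact configuration — for a function satisfying the boundary
  identification `g(Z) = g(Z^*)` of BGSR §3.1 / CIP 1994 (4.3.4) this is `C_{s,s+1} g` itself
  (`outBbgkyOp_eq_bbgkyOp_of_boundary`). The point of the outgoing reading: outgoing contact
  configurations belong to the good set of the hard-sphere flow generically, incoming ones never
  do (`HardSphereFlow.not_mem_good_of_inner_neg` of `LiouvilleBBGKY`), and the regularised flow is
  the identity off the good set; read at outgoing representatives, the backward transport inside
  the iterated Duhamel formula is the physical one (immediate collision back to the incoming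
  configuration, then free flight), as in BGSR's pseudo-trajectories (5.2);
* `Kinetic.hsHierarchyModel hε hε' N : HierarchyModel d (UnitAddTorus d)` and its unfolding
  lemmas; `duhamelTerm_hsHierarchyModel_eq_zero_of_not_mem`: Duhamel terms of data vanishing off
  the hard-sphere domains vanish off the hard-sphere domains (every level);
* `Kinetic.bgsrMarginalFamily`: the marginals `f_N^{(s)}(t)` of BGSR's datum (2.8) transported by
  the regularised `(N+1)`-sphere flow (the family `P` of `HierarchyDuhamelSeries`; its first level
  is `bgsrTaggedMarginal (Alexander.regHardSphereFlow …)`), with the everywhere a priori bound of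
  BGSR Prop. 4.1 / (4.6) in the shape `R₀ C₀^s e^{-β H_s}` (`abs_bgsrMarginalFamily_le`) and
  measurability; `bgsrMarginalFamily_zero_eq_zero_of_not_mem` etc.;
* `bgsrTaggedMarginal_ae_eq_of_flows`, `bgsrTaggedMarginal_ae_eq_bgsrMarginalFamily`: the tagged
  distribution `f_N^{(1)}(t)` of N1 does not depend on the hard-sphere flow up to null sets
  (`HardSphereFlow.flow_eq_ae_holds`, Fubini), so a.e. statements about it may be proved along
  the regularised flow;
* **the BBGKY side of Theorem 2.2 reduced to two inputs** (`bgsrMarginal_ae_abs_sub_blockComp_le`):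
  if the marginal family agrees a.e. with the finite Duhamel series of its initial value (the
  iterated Duhamel formula up to null sets — Spohn 2006 Thm 11 / Cor. 12, Simonella 2014,
  GSRT 2013) and the Duhamel terms of the model respect Lebesgue-null sets
  (`HierarchyModel.RespectsAE`, Spohn's "independently of the chosen versions"), then BGSR
  Proposition 4.3 holds for `f_N^{(1)}` almost everywhere:
  `|f_N^{(1)}(Kh) - f_N^{(1,K)}(Kh)| ≤ 4 γ^A ‖ρ⁰‖_∞ C₀` a.e.; and, with the abstract Props. 5.4–5.5
  (N5d₁, N5d₃), `bgsrMarginal_ae_abs_sub_truncSepMain_le` — the BBGKY twin of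
  `abs_bgsrHierarchyFamily_sub_truncSepMain_le` (`TaggedBoltzmannTruncation`).

## References

* T. Bodineau, I. Gallagher, L. Saint-Raymond, *The Brownian motion as the limit of a
  deterministic system of hard-spheres*, Invent. Math. 203 (2016) 493–553 = arXiv:1305.3397v2,
  §3.1 p. 9 (hierarchy, trace condition, iterated Duhamel formula, Remark 3.1), §4.1 Prop. 4.1,
  §4.3–4.4 Prop. 4.3, pp. 11–14; §5.1 (5.2) p. 15.
* H. Spohn, *On the integrated form of the BBGKY hierarchy for hard spheres* (1985/2006),
  arXiv:math-ph/0605068, Prop. 5, Prop. 8, Thm 11, Cor. 12.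
* C. Cercignani, R. Illner, M. Pulvirenti, *The Mathematical Theory of Dilute Gases* (1994),
  §4.3 (4.3.4), Thm 4.3.1.
* I. Gallagher, L. Saint-Raymond, B. Texier, *From Newton to Boltzmann* (2013), (4.3.5)–(4.3.8).
-/

open MeasureTheory Metric Real Set Filter Function
open scoped Nat InnerProductSpace
open Literature.Analysis.FluidPDE (Config configEnergy GCState duhamelTerm duhamelTerm_zero
  duhamelTerm_succ Geometry hardSphereDomain collidePair hsCollisionTerm bbgkyCollisionOp bbgkyOp
  lossConfig gainConfig appendParticle nthMarginal hsTransport HardSphereFlow)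

namespace Literature.MathematicalPhysics.KineticTheory

noncomputable section

section Kinetic

variable {d : Type*} [Fintype d] {X : Type*}

/-! ## The BBGKY collision operator read at outgoing representatives -/

section OutOp

variable (G : Geometry d X) (ε : ℝ)

/-- The outgoing (post-collisional) representative of the pair `(i, s+1)` of an
`(s+1)`-particle configuration: the elastic reflection `collidePair i (s+1)` (positions
unchanged). On the contact set of the pair it exchanges incoming and outgoing configurations;
the trace condition of BGSR §3.1 reads `f_N(t, Z) = f_N(t, Z^*)` there. [cite: BodineauGallagherSaintRaymondInvent2016, §3.1, p. 9] -/
def outRep (s : ℕ) (i : Fin s) (Z : Config (s + 1) d X) : Config (s + 1) d X :=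
  collidePair G (Fin.castAdd 1 i) (Fin.natAdd s 0) Z

/-- **The BBGKY collision operator read at outgoing representatives**:
`(C^{out}_{s,s+1} g)(Z_s) = (N - s) ε^{d-1} ∑_{i<s} C^i_{s,s+1}[g ∘ outRep i](Z_s)` — the tree's
`bbgkyOp` (GST 2013 (4.3.5)–(4.3.6): gain term at `(…, x_i, v_i^*, …, x_i + εω, v^*)`, loss
term at `(Z_s, x_i + εω, v)`, both incoming) with each evaluation moved to the post-collisional
partner: gain at `(…, x_i, v_i, …, x_i + εω, v)`, loss at `(…, x_i, v_i', …, x_i + εω, v')`. For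
`g` satisfying the boundary identification this is `C_{s,s+1} g`
(`outBbgkyOp_eq_bbgkyOp_of_boundary`). [cite: BodineauGallagherSaintRaymondInvent2016, §3.1, p. 9] -/
def outBbgkyOp (N s : ℕ) (g : Config (s + 1) d X → ℝ) (Zs : Config s d X) : ℝ :=
  ∑ i : Fin s, bbgkyCollisionOp G ε ((N - s : ℕ) : ℝ) s i (g ∘ outRep G s i) Zs

variable {G ε}

/-- The two indices of the pair `(i, s+1)` are distinct. [folklore] -/
theorem castAdd_ne_natAdd {s : ℕ} (i : Fin s) : (Fin.castAdd 1 i : Fin (s + 1)) ≠ Fin.natAdd s 0 := by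
  intro h
  have := congrArg Fin.val h
  have hi := i.isLt
  simp at this
  omega

/-- The outgoing representative has the kinetic energy of the configuration. [folklore] -/
@[simp]
theorem configEnergy_outRep {s : ℕ} (i : Fin s) (Z : Config (s + 1) d X) :
    configEnergy (outRep G s i Z) = configEnergy Z :=
  Literature.Analysis.FluidPDE.configEnergy_collidePair (castAdd_ne_natAdd i) Z

/-- The outgoing representative lies in the hard-sphere domain iff the configuration does
(positions are unchanged). [folklore] -/
theorem outRep_mem_hardSphereDomain_iff {s : ℕ} (i : Fin s) (Z : Config (s + 1) d X) :
    outRep G s i Z ∈ hardSphereDomain G (s + 1) ε ↔ Z ∈ hardSphereDomain G (s + 1) ε :=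
  Literature.Analysis.FluidPDE.collidePair_mem_hardSphereDomain_iff Z

/-- A Gaussian bound is preserved by composition with the outgoing representative. [folklore] -/
theorem abs_comp_outRep_le {s : ℕ} (i : Fin s) {g : Config (s + 1) d X → ℝ} {K b : ℝ}
    (hg : ∀ Z, |g Z| ≤ K * exp (-b * configEnergy Z)) (Z : Config (s + 1) d X) :
    |(g ∘ outRep G s i) Z| ≤ K * exp (-b * configEnergy Z) := by
  simpa only [Function.comp_apply, configEnergy_outRep] using hg (outRep G s i Z)

/-- The outgoing representative is a measurable map (measurable geometry). [folklore] -/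
theorem measurable_outRep [MeasurableSpace X] (hGm : G.IsMeasurable) (s : ℕ) (i : Fin s) :
    Measurable (outRep G s i : Config (s + 1) d X → Config (s + 1) d X) :=
  hGm.measurable_collidePair _ _

/-- Composition with the outgoing representative preserves the Lanford class. [folklore] -/
theorem IsNice.comp_outRep [MeasurableSpace X] (hGm : G.IsMeasurable) {s : ℕ} (i : Fin s)
    {g : Config (s + 1) d X → ℝ} (hg : IsNice g) : IsNice (g ∘ outRep G s i) := by
  obtain ⟨K, b, hb, h⟩ := hg.2
  exact ⟨hg.1.comp (measurable_outRep hGm s i), K, b, hb, abs_comp_outRep_le i h⟩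

/-- If `g` takes the same value at a configuration and at its outgoing representative for every
pair `(i, s+1)` (the boundary identification of BGSR §3.1 / CIP 1994 (4.3.4) holds for `g`, e.g.
`g` collision-invariant), the outgoing reading of the collision operator is the collision operator
of the tree. [cite: BodineauGallagherSaintRaymondInvent2016, §3.1, p. 9] -/
theorem outBbgkyOp_eq_bbgkyOp_of_boundary (N s : ℕ) {g : Config (s + 1) d X → ℝ}
    (hg : ∀ (i : Fin s) (Z : Config (s + 1) d X), g (outRep G s i Z) = g Z) (Zs : Config s d X) :
    outBbgkyOp G ε N s g Zs = bbgkyOp G ε N s g Zs := by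
  unfold outBbgkyOp Literature.Analysis.FluidPDE.bbgkyOp
  refine Finset.sum_congr rfl fun i _ => ?_
  have : g ∘ outRep G s i = g := funext fun Z => hg i Z
  rw [this]

/-- Homogeneity of the outgoing collision operator. [folklore] -/
theorem outBbgkyOp_smul (N s : ℕ) (c : ℝ) (g : Config (s + 1) d X → ℝ) :
    outBbgkyOp G ε N s (c • g) = c • outBbgkyOp G ε N s g := by
  funext Zs
  simp only [outBbgkyOp, Pi.smul_apply, smul_eq_mul, Literature.Analysis.FluidPDE.bbgkyCollisionOp,
    Finset.mul_sum]
  refine Finset.sum_congr rfl fun i _ => ?_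
  have : (c • g) ∘ outRep G s i = c • (g ∘ outRep G s i) := rfl
  rw [this, hsCollisionTerm_smul]
  ring

/-- The top outgoing collision operator vanishes: `C^{out}_{N,N+1} = 0` (prefactor `N - N`), and so
do all higher ones. [folklore] -/
theorem outBbgkyOp_eq_zero_of_le {N s : ℕ} (h : N ≤ s) (g : Config (s + 1) d X → ℝ) :
    outBbgkyOp G ε N s g = 0 := by
  funext Zs
  simp [outBbgkyOp, Literature.Analysis.FluidPDE.bbgkyCollisionOp, Nat.sub_eq_zero_of_le h]

variable [MeasurableSpace X]

/-- **Additivity of the outgoing collision operator** on finite sums of nice densities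
(`hsCollisionTerm_finset_sum` applied to the compositions with the outgoing representatives).
[folklore] -/
theorem outBbgkyOp_finset_sum (hGm : G.IsMeasurable) (N s : ℕ) {ι : Type*} (S : Finset ι)
    {g : ι → Config (s + 1) d X → ℝ} (hg : ∀ n ∈ S, IsNice (g n)) :
    outBbgkyOp G ε N s (∑ n ∈ S, g n) = ∑ n ∈ S, outBbgkyOp G ε N s (g n) := by
  funext Zs
  simp only [Finset.sum_apply, outBbgkyOp, Literature.Analysis.FluidPDE.bbgkyCollisionOp]
  rw [Finset.sum_comm]
  refine Finset.sum_congr rfl fun i _ => ?_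
  have hcomp : (∑ n ∈ S, g n) ∘ outRep G s i = ∑ n ∈ S, (g n ∘ outRep G s i) := by
    funext Z
    simp [Finset.sum_apply]
  rw [hcomp, Literature.Analysis.FluidPDE.hsCollisionTerm_finset_sum hGm.measurable_translate ε i S
    (fun n hn => ((hg n hn).comp_outRep hGm i).1) (fun n hn => ((hg n hn).comp_outRep hGm i).2) Zs,
    Finset.mul_sum]

/-- The outgoing collision operator of a measurably parametrised density is jointly measurable in
the parameter and the configuration. [folklore] -/
theorem measurable_outBbgkyOp_param (hGm : G.IsMeasurable) (N s : ℕ) {α : Type*} [MeasurableSpace α]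
    {u : α × Config (s + 1) d X → ℝ} (hu : Measurable u) :
    Measurable fun p : α × Config s d X => outBbgkyOp G ε N s (fun Z => u (p.1, Z)) p.2 := by
  unfold outBbgkyOp Literature.Analysis.FluidPDE.bbgkyCollisionOp
  refine Finset.measurable_sum _ fun i _ => ?_
  have hu' : Measurable fun q : α × Config (s + 1) d X => u (q.1, outRep G s i q.2) :=
    hu.comp (measurable_fst.prodMk ((measurable_outRep hGm s i).comp measurable_snd))
  exact (Literature.Analysis.FluidPDE.measurable_hsCollisionTerm_param hGm.measurable_translate ε i hu').const_mul _

omit [MeasurableSpace X] in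
/-- **BGSR (4.11) for the outgoing collision operator** (`ε ≥ 0`): if `|g| ≤ K e^{-λ H_{k+1}}` then
`|C^{out}_{k,k+1} g (Z_k)| ≤ N ε^{d-1} C_d λ^{-d/2} (k λ^{-1/2} + ∑_{i<k} |v_i|) K e^{-λ H_k(Z_k)}`
— the bound `abs_bbgkyOp_le_weighted` of N3, the compositions `g ∘ outRep i` obeying the same
Gaussian bound. [cite: BodineauGallagherSaintRaymondInvent2016, §4.2 (4.11), pp. 11–12] -/
theorem abs_outBbgkyOp_le_weighted {ε : ℝ} (hε : 0 ≤ ε) (N s : ℕ) {K b : ℝ} (hb : 0 < b)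
    {g : Config (s + 1) d X → ℝ} (hg : ∀ Z, |g Z| ≤ K * exp (-b * configEnergy Z))
    (Zs : Config s d X) :
    |outBbgkyOp G ε N s g Zs| ≤
      ((N * ε ^ (Fintype.card d - 1)) *
        ((∫ u : EuclideanSpace ℝ d, (1 + ‖u‖) * exp (-(1 / 2) * ‖u‖ ^ 2)) *
          (KineticTheory.sphereMeasure : Measure (sphere (0 : EuclideanSpace ℝ d) 1)).real univ)) *
        (sqrt b ^ Fintype.card d)⁻¹ * (s * (sqrt b)⁻¹ + ∑ i, ‖(Zs i).2‖) *
        (K * exp (-b * configEnergy Zs)) := by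
  set C := (∫ u : EuclideanSpace ℝ d, (1 + ‖u‖) * exp (-(1 / 2) * ‖u‖ ^ 2)) *
    (KineticTheory.sphereMeasure : Measure (sphere (0 : EuclideanSpace ℝ d) 1)).real univ with hC
  have hpref : |((N - s : ℕ) : ℝ) * ε ^ (Fintype.card d - 1)| ≤ N * ε ^ (Fintype.card d - 1) := by
    rw [abs_of_nonneg (by positivity)]
    gcongr
    exact_mod_cast Nat.sub_le N s
  unfold outBbgkyOp Literature.Analysis.FluidPDE.bbgkyCollisionOp
  calc |∑ i : Fin s, ((N - s : ℕ) : ℝ) * ε ^ (Fintype.card d - 1) *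
          hsCollisionTerm G ε s i (g ∘ outRep G s i) Zs|
      ≤ ∑ i : Fin s, |((N - s : ℕ) : ℝ) * ε ^ (Fintype.card d - 1) *
          hsCollisionTerm G ε s i (g ∘ outRep G s i) Zs| := Finset.abs_sum_le_sum_abs _ _
    _ = ∑ i : Fin s, |((N - s : ℕ) : ℝ) * ε ^ (Fintype.card d - 1)| *
          |hsCollisionTerm G ε s i (g ∘ outRep G s i) Zs| :=
        Finset.sum_congr rfl fun i _ => abs_mul _ _
    _ ≤ ∑ i : Fin s, (N * ε ^ (Fintype.card d - 1)) *
          (C * (sqrt b ^ Fintype.card d)⁻¹ * ((sqrt b)⁻¹ + ‖(Zs i).2‖) *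
            (K * exp (-b * configEnergy Zs))) :=
        Finset.sum_le_sum fun i _ => mul_le_mul hpref
          (abs_hsCollisionTerm_le_weighted G ε i hb (abs_comp_outRep_le i hg) Zs)
          (abs_nonneg _) (by positivity)
    _ = _ := by
        rw [← Finset.mul_sum, ← Finset.sum_mul, ← Finset.mul_sum, Finset.sum_add_distrib,
          Finset.sum_const, Finset.card_univ, Fintype.card_fin, nsmul_eq_mul]
        ring

end OutOp

/-! ## Configurations outside the hard-sphere domain stay outside under adjunction -/

section Domain

variable {G : Geometry d X} {ε : ℝ}

/-- A configuration with the same positions as one outside the hard-sphere domain is outside the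
hard-sphere domain. [folklore] -/
theorem not_mem_hardSphereDomain_of_pos_eq {s : ℕ} {Z Z' : Config s d X}
    (hpos : ∀ k, (Z' k).1 = (Z k).1) (hZ : Z ∉ hardSphereDomain G s ε) :
    Z' ∉ hardSphereDomain G s ε := by
  intro h'
  apply hZ
  rw [Literature.Analysis.FluidPDE.mem_hardSphereDomain] at h' ⊢
  intro i j hij
  simpa only [hpos] using h' i j hij

/-- Adjoining a particle to a configuration outside the hard-sphere domain gives a configuration
outside the hard-sphere domain. [folklore] -/
theorem appendParticle_not_mem_hardSphereDomain {s : ℕ} {Zs : Config s d X}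
    (hZs : Zs ∉ hardSphereDomain G s ε) (x : X) (v : EuclideanSpace ℝ d) :
    appendParticle Zs x v ∉ hardSphereDomain G (s + 1) ε := by
  intro h
  apply hZs
  rw [Literature.Analysis.FluidPDE.mem_hardSphereDomain] at h ⊢
  intro i j hij
  have hne : (Fin.castAdd 1 i : Fin (s + 1)) ≠ Fin.castAdd 1 j := fun h' => hij (Fin.castAdd_injective _ _ h')
  simpa only [Literature.Analysis.FluidPDE.appendParticle_castAdd] using h _ _ hne

/-- The loss configuration over a configuration outside the hard-sphere domain is outside the
hard-sphere domain. [folklore] -/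
theorem lossConfig_not_mem_hardSphereDomain {s : ℕ} {Zs : Config s d X}
    (hZs : Zs ∉ hardSphereDomain G s ε) (i : Fin s) (ω v : EuclideanSpace ℝ d) :
    lossConfig G ε Zs i ω v ∉ hardSphereDomain G (s + 1) ε :=
  appendParticle_not_mem_hardSphereDomain hZs _ _

/-- The gain configuration over a configuration outside the hard-sphere domain is outside the
hard-sphere domain. [folklore] -/
theorem gainConfig_not_mem_hardSphereDomain {s : ℕ} {Zs : Config s d X}
    (hZs : Zs ∉ hardSphereDomain G s ε) (i : Fin s) (ω v : EuclideanSpace ℝ d) :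
    gainConfig G ε Zs i ω v ∉ hardSphereDomain G (s + 1) ε := by
  unfold Literature.Analysis.FluidPDE.gainConfig
  refine appendParticle_not_mem_hardSphereDomain (not_mem_hardSphereDomain_of_pos_eq (fun k => ?_) hZs) _ _
  by_cases hk : k = i
  · subst hk; simp
  · simp [Function.update_of_ne hk]

/-- **The outgoing collision operator of a function vanishing off `D_ε^{s+1}` vanishes off
`D_ε^s`**: over a configuration violating the exclusion, every adjoined configuration (gain or
loss) and its outgoing representative violate it. [folklore] -/
theorem outBbgkyOp_eq_zero_of_not_mem (N : ℕ) {s : ℕ} {g : Config (s + 1) d X → ℝ}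
    (hg : ∀ Z ∉ hardSphereDomain G (s + 1) ε, g Z = 0) {Zs : Config s d X}
    (hZs : Zs ∉ hardSphereDomain G s ε) : outBbgkyOp G ε N s g Zs = 0 := by
  have h1 : ∀ (i : Fin s) (ω v : EuclideanSpace ℝ d), g (outRep G s i (gainConfig G ε Zs i ω v)) = 0 :=
    fun i ω v => hg _ (mt (outRep_mem_hardSphereDomain_iff i _).1
      (gainConfig_not_mem_hardSphereDomain hZs i ω v))
  have h2 : ∀ (i : Fin s) (ω v : EuclideanSpace ℝ d), g (outRep G s i (lossConfig G ε Zs i ω v)) = 0 :=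
    fun i ω v => hg _ (mt (outRep_mem_hardSphereDomain_iff i _).1
      (lossConfig_not_mem_hardSphereDomain hZs i ω v))
  simp [outBbgkyOp, Literature.Analysis.FluidPDE.bbgkyCollisionOp,
    Literature.Analysis.FluidPDE.hsCollisionTerm, Function.comp_apply, h1, h2]

end Domain

/-! ## The model on the torus -/

section Model

local notation "𝕋" => UnitAddTorus d

/-- **The BBGKY hierarchy of `N` hard spheres of diameter `ε` on `T^d` as a `HierarchyModel`**
(`0 < ε < 1/2`): transports along the regularised Alexander flows of every particle number
(`Alexander.regFlow`, groups on the whole phase space), collision operators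
`C^{out}_{s,s+1}` (`outBbgkyOp`, the tree's `C_{s,s+1}` read at outgoing representatives),
constant of (4.11) `opConst = N ε^{d-1} C_d` as for `bbgkyModel`. Its finite Duhamel series of
the initial marginals is BGSR's iterated Duhamel formula (§3.1) for the tagged hard-sphere system,
with the backward transports of the pseudo-trajectories (5.2) realised by the hard-sphere flow.
[cite: BodineauGallagherSaintRaymondInvent2016, §3.1, p. 9] -/
def hsHierarchyModel {ε : ℝ} (hε : 0 < ε) (hε' : ε < 2⁻¹) (N : ℕ) : HierarchyModel d 𝕋 where
  flow := fun s t => Literature.Analysis.FluidPDE.Alexander.regFlow (N := s)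
    (Literature.Analysis.FluidPDE.Torus.geometry d) ε t
  op := outBbgkyOp (Literature.Analysis.FluidPDE.Torus.geometry d) ε N
  opConst := (N * ε ^ (Fintype.card d - 1)) *
    ((∫ u : EuclideanSpace ℝ d, (1 + ‖u‖) * exp (-(1 / 2) * ‖u‖ ^ 2)) *
      (KineticTheory.sphereMeasure : Measure (sphere (0 : EuclideanSpace ℝ d) 1)).real univ)
  configEnergy_flow := fun s t Z => Literature.Analysis.FluidPDE.Alexander.configEnergy_regFlow t Z
  measurable_flow := fun s => Literature.Analysis.FluidPDE.Alexander.measurable_regFlow_uncurry hε'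
  measurable_op := fun s u hu =>
    measurable_outBbgkyOp_param Literature.Analysis.FluidPDE.Torus.isMeasurable_geometry N s hu
  op_add := fun s g₁ g₂ h₁ h₂ => by
    have h := outBbgkyOp_finset_sum (ε := ε) Literature.Analysis.FluidPDE.Torus.isMeasurable_geometry N s
      (Finset.univ : Finset Bool) (g := fun b => bif b then g₁ else g₂)
      (fun b _ => by cases b <;> simp only [cond_true, cond_false] <;> first | exact h₁ | exact h₂)
    simpa [Fintype.sum_bool] using h
  op_smul := fun s c g => outBbgkyOp_smul N s c g
  opConst_nonneg := by
    haveI := Literature.Analysis.FluidPDE.isFiniteMeasure_sphereMeasure (E := EuclideanSpace ℝ d)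
    have hJ : 0 ≤ ∫ u : EuclideanSpace ℝ d, (1 + ‖u‖) * exp (-(1 / 2) * ‖u‖ ^ 2) :=
      integral_nonneg fun u => by positivity
    have hε0 : 0 ≤ ε := hε.le
    exact mul_nonneg (by positivity) (mul_nonneg hJ measureReal_nonneg)
  op_weighted := fun k g K b hb _ hg Z => abs_outBbgkyOp_le_weighted hε.le N k hb hg Z

variable {ε : ℝ} (hε : 0 < ε) (hε' : ε < 2⁻¹) (N : ℕ)

/-- The flows of the hard-sphere model are the regularised Alexander flows. [folklore] -/
@[simp]
theorem hsHierarchyModel_flow (s : ℕ) (t : ℝ) :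
    (hsHierarchyModel (d := d) hε hε' N).flow s t =
      Literature.Analysis.FluidPDE.Alexander.regFlow (Literature.Analysis.FluidPDE.Torus.geometry d) ε t := rfl

/-- The collision operators of the hard-sphere model are the outgoing BBGKY operators. [folklore] -/
@[simp]
theorem hsHierarchyModel_op (s : ℕ) (g : Config (s + 1) d 𝕋 → ℝ) :
    (hsHierarchyModel (d := d) hε hε' N).op s g =
      outBbgkyOp (Literature.Analysis.FluidPDE.Torus.geometry d) ε N s g := rfl

/-- The transports of the hard-sphere model, unfolded. [folklore] -/
theorem hsHierarchyModel_transport_apply (s : ℕ) (t : ℝ) (g : Config s d 𝕋 → ℝ) (Z : Config s d 𝕋) :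
    (hsHierarchyModel (d := d) hε hε' N).transport s t g Z =
      g (Literature.Analysis.FluidPDE.Alexander.regFlow (Literature.Analysis.FluidPDE.Torus.geometry d) ε (-t) Z) :=
  rfl

/-- **The transports of the hard-sphere model form groups on the whole phase space** (the
hypothesis `hflow` of `HierarchyDuhamelSeries`: `Alexander.regFlow_add`). [folklore] -/
theorem hsHierarchyModel_flow_add (s : ℕ) (a b : ℝ) (Z : Config s d 𝕋) :
    (hsHierarchyModel (d := d) hε hε' N).flow s (a + b) Z =
      (hsHierarchyModel hε hε' N).flow s a ((hsHierarchyModel hε hε' N).flow s b Z) :=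
  Literature.Analysis.FluidPDE.Alexander.regFlow_add hε hε' a b Z

/-- The transports of the hard-sphere model at time `0` are the identity. [folklore] -/
theorem hsHierarchyModel_flow_zero (s : ℕ) (Z : Config s d 𝕋) :
    (hsHierarchyModel (d := d) hε hε' N).flow s 0 Z = Z :=
  Literature.Analysis.FluidPDE.Alexander.regFlow_zero hε hε' Z

/-- Off the good set — in particular off the hard-sphere domain — the transports of the model fix
the configuration. [folklore] -/
theorem hsHierarchyModel_flow_of_not_mem {s : ℕ} {Z : Config s d 𝕋}
    (hZ : Z ∉ hardSphereDomain (Literature.Analysis.FluidPDE.Torus.geometry d) s ε) (t : ℝ) :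
    (hsHierarchyModel (d := d) hε hε' N).flow s t Z = Z :=
  Literature.Analysis.FluidPDE.Alexander.regFlow_of_not_mem
    (fun h => hZ (Literature.Analysis.FluidPDE.Alexander.good_subset_hardSphereDomain h)) t

/-- **Duhamel terms of data vanishing off the hard-sphere domains vanish off the hard-sphere
domains**, at every level and order: a pseudo-trajectory issued from a configuration violating
the exclusion keeps violating it (the regularised flow fixes it, adjunctions preserve the
violation, `outBbgkyOp_eq_zero_of_not_mem`), and the datum vanishes there. [folklore] -/
theorem duhamelTerm_hsHierarchyModel_eq_zero_of_not_mem {f₀ : GCState d 𝕋}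
    (hf₀ : ∀ (k : ℕ), ∀ Z ∉ hardSphereDomain (Literature.Analysis.FluidPDE.Torus.geometry d) k ε, f₀ k Z = 0)
    (n : ℕ) : ∀ (s : ℕ) (t : ℝ), ∀ Z ∉ hardSphereDomain (Literature.Analysis.FluidPDE.Torus.geometry d) s ε,
      duhamelTerm (hsHierarchyModel (d := d) hε hε' N).transport (hsHierarchyModel hε hε' N).op n s t f₀ Z = 0 := by
  induction n with
  | zero =>
    intro s t Z hZ
    rw [duhamelTerm_zero, HierarchyModel.transport_apply, hsHierarchyModel_flow_of_not_mem hε hε' N hZ]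
    exact hf₀ s Z hZ
  | succ n ih =>
    intro s t Z hZ
    rw [duhamelTerm_succ]
    refine intervalIntegral.integral_zero_ae (Eventually.of_forall fun τ _ => ?_)
    rw [HierarchyModel.transport_apply, hsHierarchyModel_flow_of_not_mem hε hε' N hZ, hsHierarchyModel_op]
    exact outBbgkyOp_eq_zero_of_not_mem N (fun Z' hZ' => ih (s + 1) τ Z' hZ') hZ

/-- The finite Duhamel series of data vanishing off the hard-sphere domains vanishes off the
hard-sphere domains. [folklore] -/
theorem seriesFamily_hsHierarchyModel_eq_zero_of_not_mem {f₀ : GCState d 𝕋}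
    (hf₀ : ∀ (k : ℕ), ∀ Z ∉ hardSphereDomain (Literature.Analysis.FluidPDE.Torus.geometry d) k ε, f₀ k Z = 0)
    (Nmax s : ℕ) (t : ℝ) {Z : Config s d 𝕋}
    (hZ : Z ∉ hardSphereDomain (Literature.Analysis.FluidPDE.Torus.geometry d) s ε) :
    (hsHierarchyModel (d := d) hε hε' N).seriesFamily Nmax f₀ s t Z = 0 := by
  rw [HierarchyModel.seriesFamily_apply]
  exact Finset.sum_eq_zero fun n _ => duhamelTerm_hsHierarchyModel_eq_zero_of_not_mem hε hε' N hf₀ n s t Z hZ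

end Model

/-! ## The marginals of the transported BGSR datum and the reduction of Proposition 4.3 -/

section Marginals

local notation "𝕋" => UnitAddTorus d
local notation "𝔼" => EuclideanSpace ℝ d

attribute [local instance] sigmaFinite_volume_phaseSpace

variable {ε : ℝ} (hε : 0 < ε) (hε' : ε < 2⁻¹) (N : ℕ) (β : ℝ) (ρ₀ : UnitAddTorus d → ℝ)

/-- **The marginals of BGSR's transported datum**, along the regularised flows:
`f_N^{(s)}(t) := ∫ (1_{good} · f_N^0 ∘ Φ^{N+1}_{-t})(Z_s, ·)` for the datum (2.8)
`f_N^0 = M_{N,β} ρ⁰(x₁)` of `N + 1` spheres (`bgsrInitialDensity`), the regularised Alexander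
flows `Alexander.regHardSphereFlow` at every particle number, and the honest marginals
`transportedMarginal` of `LiouvilleBBGKY` (BGSR §3.1: "the marginals
`f_N^{(s)}(t, Z_s) := ∫ f_N(t, Z_N) dz_{s+1} … dz_N`"; Spohn 2006 (14b)–(14c), the version with
`f_N(t) = 0` off `Γ_N^*`). Its first level is the tagged distribution `bgsrTaggedMarginal` of N1
for the regularised flow (`bgsrMarginalFamily_one`). This is the family `P` of
`HierarchyDuhamelSeries`, obeying BGSR's a priori bound (4.6) at EVERY point.
[cite: BodineauGallagherSaintRaymondInvent2016, §3.1, p. 9] -/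
def bgsrMarginalFamily : (s : ℕ) → ℝ → Config s d 𝕋 → ℝ :=
  Literature.Analysis.FluidPDE.transportedMarginal
    (fun k => Literature.Analysis.FluidPDE.Alexander.regHardSphereFlow (d := d) hε hε' k)
    (bgsrInitialDensity ε N β ρ₀)

/-- Unfolding lemma for the marginal family. [folklore] -/
theorem bgsrMarginalFamily_apply (s : ℕ) (t : ℝ) :
    bgsrMarginalFamily (d := d) hε hε' N β ρ₀ s t =
      nthMarginal (N + 1) s
        ((Literature.Analysis.FluidPDE.Alexander.regHardSphereFlow (d := d) hε hε' (N + 1)).good.indicator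
          (hsTransport (Literature.Analysis.FluidPDE.Alexander.regHardSphereFlow (d := d) hε hε' (N + 1)) t
            (bgsrInitialDensity ε N β ρ₀))) :=
  rfl

/-- **The first level of the marginal family is the tagged distribution `f_N^{(1)}`** of N1
(`bgsrTaggedMarginal`) for the regularised `(N+1)`-sphere flow. [folklore] -/
theorem bgsrMarginalFamily_one (t : ℝ) (x : 𝕋) (v : 𝔼) :
    bgsrMarginalFamily (d := d) hε hε' N β ρ₀ 1 t (fun _ => (x, v)) =
      bgsrTaggedMarginal (Literature.Analysis.FluidPDE.Alexander.regHardSphereFlow (d := d) hε hε' (N + 1))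
        β ρ₀ t x v :=
  rfl

/-- The marginal family vanishes above `N + 1` particles. [folklore] -/
theorem bgsrMarginalFamily_eq_zero_of_lt {s : ℕ} (hs : N + 1 < s) (t : ℝ) :
    bgsrMarginalFamily (d := d) hε hε' N β ρ₀ s t = 0 := by
  funext Z
  rw [bgsrMarginalFamily_apply]
  simp [Literature.Analysis.FluidPDE.nthMarginal, not_le.2 hs]

/-- The marginal family vanishes off the hard-sphere domains (LiouvilleBBGKY
`transportedMarginal_eq_zero_of_not_mem`). [folklore] -/
theorem bgsrMarginalFamily_eq_zero_of_not_mem (s : ℕ) (t : ℝ) {Z : Config s d 𝕋}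
    (hZ : Z ∉ hardSphereDomain (Literature.Analysis.FluidPDE.Torus.geometry d) s ε) :
    bgsrMarginalFamily (d := d) hε hε' N β ρ₀ s t Z = 0 :=
  Literature.Analysis.FluidPDE.transportedMarginal_eq_zero_of_not_mem _ _ t hZ

/-- The marginal family is nonnegative (`ρ⁰ ≥ 0`, `β > 0`). [folklore] -/
theorem bgsrMarginalFamily_nonneg (hβ : 0 < β) (hρ₀0 : ∀ x, 0 ≤ ρ₀ x) (s : ℕ) (t : ℝ)
    (Z : Config s d 𝕋) : 0 ≤ bgsrMarginalFamily (d := d) hε hε' N β ρ₀ s t Z := by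
  rw [bgsrMarginalFamily_apply, Literature.Analysis.FluidPDE.nthMarginal]
  split_ifs with hs
  · exact integral_nonneg fun zm => indicator_hsTransport_bgsrInitialDensity_nonneg hβ hρ₀0 _ t _
  · exact le_rfl

/-- Each slice of the marginal family is measurable (measurable `ρ⁰`). [folklore] -/
theorem measurable_bgsrMarginalFamily (hρ₀m : Measurable ρ₀) (s : ℕ) (t : ℝ) :
    Measurable (bgsrMarginalFamily (d := d) hε hε' N β ρ₀ s t) := by
  rw [bgsrMarginalFamily_apply]
  refine Literature.Analysis.FluidPDE.measurable_nthMarginal (N + 1) s ?_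
  refine Measurable.indicator ?_
    (Literature.Analysis.FluidPDE.Alexander.regHardSphereFlow (d := d) hε hε' (N + 1)).measurableSet_good
  exact (measurable_bgsrInitialDensity hρ₀m ε N β).comp
    ((Literature.Analysis.FluidPDE.Alexander.regHardSphereFlow (d := d) hε hε' (N + 1)).measurable_flow (-t))

/-- **BGSR Proposition 4.1 / (4.6) at every point, in the shape consumed by the pruning
estimates**: in the regime `N (2ε)^d ≤ 1/2`, for `0 ≤ ρ⁰ ≤ R`, every level `s`, time `t` and
configuration `Z_s`, `|f_N^{(s)}(t, Z_s)| ≤ R (max 1 (2 (β/2π)^{d/2}))^s e^{-β H_s(Z_s)}` —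
`nthMarginal_hsTransport_le_two_pow` of N1 (maximum principle against the Gibbs measure and
Prop. 3.2, `f_N^{(s)} ≤ ‖ρ⁰‖_∞ 2^s M_β^{⊗s}`) with `M_β^{⊗s}(V_s) = ((β/2π)^{d/2})^s e^{-β H_s}`; the
levels `s > N + 1` vanish. [cite: BodineauGallagherSaintRaymondInvent2016, §4.1 Prop. 4.1 and §4.3 (4.6), pp. 11–12] -/
theorem abs_bgsrMarginalFamily_le (hβ : 0 < β) {R : ℝ} (hρ₀0 : ∀ x, 0 ≤ ρ₀ x) (hR : ∀ x, ρ₀ x ≤ R)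
    (hN : (N : ℝ) * (2 * ε) ^ Fintype.card d ≤ 2⁻¹) (s : ℕ) (t : ℝ) (Z : Config s d 𝕋) :
    |bgsrMarginalFamily (d := d) hε hε' N β ρ₀ s t Z| ≤
      R * (max 1 (2 * maxwellianConst d β)) ^ s * exp (-β * configEnergy Z) := by
  have hR0 : 0 ≤ R := (hρ₀0 0).trans (hR 0)
  rw [abs_of_nonneg (bgsrMarginalFamily_nonneg hε hε' N β ρ₀ hβ hρ₀0 s t Z)]
  rcases le_or_gt s (N + 1) with hs | hs
  · refine (nthMarginal_hsTransport_le_two_pow hβ hε.le hρ₀0 hR hN _ t hs Z).trans ?_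
    rw [tensorPow_maxwellianBeta]
    have hc : 0 < maxwellianConst d β := maxwellianConst_pos hβ
    calc R * 2 ^ s * (maxwellianConst d β ^ s * exp (-β * configEnergy Z))
        = R * (2 * maxwellianConst d β) ^ s * exp (-β * configEnergy Z) := by rw [mul_pow]; ring
      _ ≤ R * (max 1 (2 * maxwellianConst d β)) ^ s * exp (-β * configEnergy Z) := by
          gcongr
          exact le_max_right _ _
  · rw [bgsrMarginalFamily_eq_zero_of_lt hε hε' N β ρ₀ hs]
    simp only [Pi.zero_apply]
    positivity

/-- At time `0` the finite Duhamel series of the hard-sphere model started from the initial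
marginals is the family of initial marginals (`Φ_0 = id` for the regularised flows). [folklore] -/
theorem seriesFamily_hsHierarchyModel_zero (Nmax : ℕ) (f₀ : GCState d 𝕋) (s : ℕ) :
    (hsHierarchyModel (d := d) hε hε' N).seriesFamily Nmax f₀ s 0 = f₀ s :=
  HierarchyModel.seriesFamily_zero_of_flow_zero (hsHierarchyModel_flow_zero hε hε' N) Nmax f₀ s

/-- **The BBGKY side of BGSR Theorem 2.2, reduced to two inputs about the hard-sphere flow**
(Proposition 4.3 for the tagged distribution, almost everywhere). Consider `N + 1` spheres of
diameter `ε` on `T^d` (`0 < ε < 1/2`, `N (2ε)^d ≤ 1/2`), BGSR's datum (2.8) with `0 ≤ ρ⁰ ≤ R`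
measurable, `β > 0`, the marginals `f_N^{(s)}(t)` of the transported datum
(`bgsrMarginalFamily`) and the finite Duhamel series `F` of the initial marginals for the
hard-sphere model `hsHierarchyModel hε hε' (N+1)` (the right-hand side of the iterated Duhamel
formula of BGSR §3.1). ASSUME
(S) the iterated Duhamel formula up to null sets: `F^{(s)}(t) = f_N^{(s)}(t)` a.e. for `s ≤ N+1`,
`t ∈ [0, T]` (Spohn 2006 Thm 11 / Cor. 12; Simonella 2014; GSRT 2013 — NOT proved here), and
(R) the Duhamel terms of the model respect Lebesgue-null sets (`HierarchyModel.RespectsAE`, the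
"independence of the chosen versions" of Spohn 2006 Thm 11 — NOT proved here).
Then with thresholds `n_k = A^k` (`A ≥ 2`), `0 ≤ γ ≤ 1/2`, `Kh ≤ T` and the step condition
`C₀ c_R h ≤ γ/e²` (`C₀ = max 1 (2 (β/2π)^{d/2})`, `c_R = pruneConst`), the tagged distribution at
time `Kh` differs from the main term `f_N^{(1,K)}(Kh) = (blockComp K [f_N(0)])^{(1)}` of the
pruned expansion by at most `4 γ^A R C₀`, for almost every one-particle configuration
(`HierarchyModel.seriesFamily_ae_abs_sub_blockComp_le` fed with the group law of the regularised
flows, the vanishing of the marginals above `N + 1` particles, and the a priori bound (4.6)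
`abs_bgsrMarginalFamily_le`). Printed: `‖R_N^K‖_∞ ≤ C γ^A ‖ρ⁰‖_∞` (Prop. 4.3, (4.14)).
[cite: BodineauGallagherSaintRaymondInvent2016, §4.4 Prop. 4.3 (4.14), p. 13] -/
theorem bgsrMarginal_ae_abs_sub_blockComp_le (hβ : 0 < β) (hρ₀m : Measurable ρ₀) {R : ℝ}
    (hρ₀0 : ∀ x, 0 ≤ ρ₀ x) (hR : ∀ x, ρ₀ x ≤ R) (hN : (N : ℝ) * (2 * ε) ^ Fintype.card d ≤ 2⁻¹)
    {T : ℝ}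
    (hS : ∀ s ≤ N + 1, ∀ t ∈ Icc 0 T,
      (hsHierarchyModel (d := d) hε hε' (N + 1)).seriesFamily (N + 1)
          (fun k => bgsrMarginalFamily hε hε' N β ρ₀ k 0) s t =ᵐ[volume]
        bgsrMarginalFamily hε hε' N β ρ₀ s t)
    (hRob : (hsHierarchyModel (d := d) hε hε' (N + 1)).RespectsAE (fun _ => volume))
    {A : ℕ} (hA : 2 ≤ A) {γ : ℝ} (hγ0 : 0 ≤ γ) (hγ : γ ≤ 1 / 2) {h : ℝ} (hh0 : 0 ≤ h)
    (hsmall : max 1 (2 * maxwellianConst d β) * (hsHierarchyModel (d := d) hε hε' (N + 1)).pruneConst β * h ≤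
      γ / exp 2)
    (K : ℕ) (hKT : K * h ≤ T) :
    ∀ᵐ Z : Config 1 d 𝕋, |bgsrMarginalFamily hε hε' N β ρ₀ 1 (K * h) Z -
        (hsHierarchyModel (d := d) hε hε' (N + 1)).blockComp (pruneSeq A) h K
          (fun a => bgsrMarginalFamily hε hε' N β ρ₀ a 0) 1 Z| ≤
      4 * γ ^ A * R * max 1 (2 * maxwellianConst d β) := by
  set M := hsHierarchyModel (d := d) hε hε' (N + 1) with hMdef
  set P := bgsrMarginalFamily (d := d) hε hε' N β ρ₀ with hPdef
  set C₀ := max 1 (2 * maxwellianConst d β) with hC₀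
  have hR0 : 0 ≤ R := (hρ₀0 0).trans (hR 0)
  have hC₀1 : 1 ≤ C₀ := le_max_left _ _
  -- the initial family: nice, vanishing above `N + 1`
  have hf₀ : ∀ k, IsNice (P k 0) := fun k =>
    ⟨measurable_bgsrMarginalFamily hε hε' N β ρ₀ hρ₀m k 0, R * C₀ ^ k, β, hβ,
      abs_bgsrMarginalFamily_le hε hε' N β ρ₀ hβ hρ₀0 hR hN k 0⟩
  have hvan : ∀ k, N + 1 < k → P k 0 = 0 := fun k hk => bgsrMarginalFamily_eq_zero_of_lt hε hε' N β ρ₀ hk 0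
  -- block times lie in `[0, T]`
  have hti : ∀ i < K, K * h - (i + 1) * h ∈ Icc 0 T := by
    intro i hi
    have : (i + 1 : ℝ) ≤ K := by exact_mod_cast hi
    refine ⟨by nlinarith, ?_⟩
    nlinarith [mul_nonneg (by positivity : (0 : ℝ) ≤ i + 1) hh0]
  -- the agreement at the block times, at every level (trivial above `N + 1`)
  have hS' : ∀ i < K, ∀ k, M.seriesFamily (N + 1) (fun k => P k 0) k (K * h - (i + 1) * h) =ᵐ[volume]
      P k (K * h - (i + 1) * h) := by
    intro i hi k
    rcases le_or_gt k (N + 1) with hk | hk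
    · exact hS k hk _ (hti i hi)
    · refine Eventually.of_forall fun Z => ?_
      rw [HierarchyModel.seriesFamily_eq_zero_of_lt hvan hk, hPdef,
        bgsrMarginalFamily_eq_zero_of_lt hε hε' N β ρ₀ hk]
      rfl
  have hmain := HierarchyModel.seriesFamily_ae_abs_sub_blockComp_le (M := M) (μ := fun _ => volume)
    (hsHierarchyModel_flow_add hε hε' (N + 1)) hf₀ hvan hRob
    (fun k τ _ => measurable_bgsrMarginalFamily hε hε' N β ρ₀ hρ₀m k τ) hR0 hC₀1 hβ
    (fun k τ _ Z => abs_bgsrMarginalFamily_le hε hε' N β ρ₀ hβ hρ₀0 hR hN k τ Z)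
    hA hγ0 hγ hh0 hsmall K hKT hS'
  -- replace `F^{(1)}(Kh)` by `f_N^{(1)}(Kh)` (hypothesis (S) at level `1`) and `F(0)` by `f_N(0)`
  have hK1 : M.seriesFamily (N + 1) (fun k => P k 0) 1 (K * h) =ᵐ[volume] P 1 (K * h) :=
    hS 1 (by omega) _ ⟨by positivity, hKT⟩
  have h0 : (fun a => M.seriesFamily (N + 1) (fun k => P k 0) a 0) = fun a => P a 0 :=
    funext fun a => seriesFamily_hsHierarchyModel_zero hε hε' (N + 1) (N + 1) _ a
  filter_upwards [hmain, hK1] with Z hZ hZ1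
  rw [h0, hZ1] at hZ
  exact hZ


/-- **Transported densities along two hard-sphere flows agree almost everywhere**: for any two
hard-sphere flows `Φ`, `Ψ` of the same system, `1_{good Φ} · W ∘ Φ_{-t} = 1_{good Ψ} · W ∘ Ψ_{-t}`
Lebesgue-a.e. (both good sets are conull in `D_ε`, the flows agree a.e. there by
`HardSphereFlow.flow_eq_ae_holds`, GST 2013 Prop. 4.1.1, and both sides vanish off the good
sets). [cite: GST2013, Prop. 4.1.1 p. 19] -/
theorem indicator_hsTransport_ae_eq_of_flows {n : ℕ}
    (Φ Ψ : HardSphereFlow (Literature.Analysis.FluidPDE.Torus.geometry d) ε n) (t : ℝ)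
    (W : Config n d 𝕋 → ℝ) :
    Φ.good.indicator (hsTransport Φ t W) =ᵐ[volume] Ψ.good.indicator (hsTransport Ψ t W) := by
  have hD : MeasurableSet (hardSphereDomain (Literature.Analysis.FluidPDE.Torus.geometry d) n ε) :=
    measurableSet_hardSphereDomain_torus n ε
  have hnull : ∀ Θ : HardSphereFlow (Literature.Analysis.FluidPDE.Torus.geometry d) ε n,
      ∀ᵐ z ∂(volume : Measure (Config n d 𝕋)),
        z ∉ hardSphereDomain (Literature.Analysis.FluidPDE.Torus.geometry d) n ε ∩ Θ.goodᶜ := by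
    intro Θ
    have h := Θ.measure_compl_good
    rw [Literature.Analysis.FluidPDE.liouville_eq, Measure.restrict_apply Θ.measurableSet_good.compl,
      Set.inter_comm] at h
    exact measure_eq_zero_iff_ae_notMem.1 h
  have hflow : ∀ᵐ z ∂(volume : Measure (Config n d 𝕋)),
      z ∈ hardSphereDomain (Literature.Analysis.FluidPDE.Torus.geometry d) n ε → Φ.flow (-t) z = Ψ.flow (-t) z := by
    have h := Literature.Analysis.FluidPDE.HardSphereFlow.flow_eq_ae_holds Φ Ψ (-t)
    rw [Literature.Analysis.FluidPDE.liouville_eq, Filter.EventuallyEq, ae_restrict_iff' hD] at h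
    exact h
  filter_upwards [hnull Φ, hnull Ψ, hflow] with z hΦ hΨ hz
  by_cases hzD : z ∈ hardSphereDomain (Literature.Analysis.FluidPDE.Torus.geometry d) n ε
  · have hΦg : z ∈ Φ.good := by by_contra h; exact hΦ ⟨hzD, h⟩
    have hΨg : z ∈ Ψ.good := by by_contra h; exact hΨ ⟨hzD, h⟩
    rw [indicator_of_mem hΦg, indicator_of_mem hΨg, Literature.Analysis.FluidPDE.hsTransport_apply,
      Literature.Analysis.FluidPDE.hsTransport_apply, hz hzD]
  · rw [indicator_of_notMem (fun h => hzD (Φ.good_subset h)),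
      indicator_of_notMem (fun h => hzD (Ψ.good_subset h))]

/-- **The tagged distribution does not depend on the hard-sphere flow, almost everywhere**: for
any two hard-sphere flows of the `(N+1)`-sphere system, `f_N^{(1)}(t)` computed along `Φ` and
along `Ψ` agree for a.e. `(x, v)` (`indicator_hsTransport_ae_eq_of_flows`, sliced by Fubini
along `Config (N+1) ≃ (T^d × ℝ^d) × Config N`). [cite: GST2013, Prop. 4.1.1 p. 19] -/
theorem bgsrTaggedMarginal_ae_eq_of_flows
    (Φ Ψ : HardSphereFlow (Literature.Analysis.FluidPDE.Torus.geometry d) ε (N + 1)) (t : ℝ) :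
    ∀ᵐ z : 𝕋 × 𝔼, bgsrTaggedMarginal Φ β ρ₀ t z.1 z.2 = bgsrTaggedMarginal Ψ β ρ₀ t z.1 z.2 := by
  set e := MeasurableEquiv.piFinSuccAbove (fun _ : Fin (N + 1) => 𝕋 × 𝔼) 0 with he_def
  have hes : MeasurePreserving e.symm volume volume :=
    (volume_preserving_piFinSuccAbove (fun _ : Fin (N + 1) => 𝕋 × 𝔼) 0).symm _
  have hae := indicator_hsTransport_ae_eq_of_flows (ε := ε) Φ Ψ t (bgsrInitialDensity ε N β ρ₀)
  have hae' : ∀ᵐ p ∂(volume : Measure ((𝕋 × 𝔼) × Config N d 𝕋)),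
      Φ.good.indicator (hsTransport Φ t (bgsrInitialDensity ε N β ρ₀)) (e.symm p) =
        Ψ.good.indicator (hsTransport Ψ t (bgsrInitialDensity ε N β ρ₀)) (e.symm p) := by
    have h2 : ∀ᵐ z ∂(Measure.map e.symm (volume : Measure ((𝕋 × 𝔼) × Config N d 𝕋))),
        Φ.good.indicator (hsTransport Φ t (bgsrInitialDensity ε N β ρ₀)) z =
          Ψ.good.indicator (hsTransport Ψ t (bgsrInitialDensity ε N β ρ₀)) z := by
      rw [hes.map_eq]
      exact hae
    exact ae_of_ae_map e.symm.measurable.aemeasurable h2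
  filter_upwards [Measure.ae_ae_of_ae_prod hae'] with y hy
  obtain ⟨x, v⟩ := y
  rw [bgsrTaggedMarginal_eq_integral, bgsrTaggedMarginal_eq_integral]
  refine integral_congr_ae ?_
  filter_upwards [hy] with zm hzm
  rw [← piFinSuccAbove_zero_symm_apply ((x, v), zm)]
  exact hzm

/-- **The tagged distribution along any hard-sphere flow is the first level of the marginal
family**, almost everywhere: `bgsrTaggedMarginal Φ β ρ⁰ t = f_N^{(1)}(t)` a.e., `f_N^{(1)}` being
computed along the regularised Alexander flow (`bgsrMarginalFamily … 1`). Hence the conclusion of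
Theorem 2.2 (an a.e. statement about `bgsrTaggedMarginal (Φ k)`, `BgsrTheorem22At` /
`BgsrAeConvergenceAt`) may be proved for the regularised flow only. [cite: GST2013, Prop. 4.1.1 p. 19] -/
theorem bgsrTaggedMarginal_ae_eq_bgsrMarginalFamily
    (Φ : HardSphereFlow (Literature.Analysis.FluidPDE.Torus.geometry d) ε (N + 1)) (t : ℝ) :
    ∀ᵐ z : 𝕋 × 𝔼, bgsrTaggedMarginal Φ β ρ₀ t z.1 z.2 =
      bgsrMarginalFamily (d := d) hε hε' N β ρ₀ 1 t (fun _ => z) := by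
  filter_upwards [bgsrTaggedMarginal_ae_eq_of_flows N β ρ₀ Φ
    (Literature.Analysis.FluidPDE.Alexander.regHardSphereFlow (d := d) hε hε' (N + 1)) t] with z hz
  rw [hz, ← bgsrMarginalFamily_one hε hε' N β ρ₀ t z.1 z.2]

/-- The initial marginals `f_N(0)` obey the level bound `R C₀^k e^{-β H_k}` of the pruning
estimates at all levels (`abs_bgsrMarginalFamily_le` at `t = 0`). [folklore] -/
theorem isLevelBdd_bgsrMarginalFamily_zero (hβ : 0 < β) {R : ℝ} (hρ₀0 : ∀ x, 0 ≤ ρ₀ x)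
    (hR : ∀ x, ρ₀ x ≤ R) (hN : (N : ℝ) * (2 * ε) ^ Fintype.card d ≤ 2⁻¹) (L : ℕ) :
    IsLevelBdd (fun k => bgsrMarginalFamily (d := d) hε hε' N β ρ₀ k 0) L R
      (max 1 (2 * maxwellianConst d β)) β :=
  fun a _ Z => abs_bgsrMarginalFamily_le hε hε' N β ρ₀ hβ hρ₀0 hR hN a 0 Z

/-- **Props. 4.3, 5.4 and 5.5 for the BBGKY hierarchy of the tagged hard-sphere system,
assembled (almost everywhere, under the two inputs (S), (R) of
`bgsrMarginal_ae_abs_sub_blockComp_le`).** With `M = hsHierarchyModel hε hε' (N+1)`,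
`C' = max(1, 2(β/2π)^{d/2})`, thresholds `n_k = A^k` (`A ≥ 2`), `0 ≤ γ ≤ 1/2`, a step `h ≥ 0`
with `C' c_R h ≤ γ/e²`, `Kh ≤ T`, an energy cut-off `E` and a separation `δ ≥ 0`, the tagged
distribution `f_N^{(1)}(Kh)` differs, for almost every one-particle configuration, from the
truncated, separated main term `(sepBlockComp δ K [1_{H ≤ E²/2} f_N(0)])^{(1)}` by at most the
sum of the pruning remainder (`bgsrMarginal_ae_abs_sub_blockComp_le`, `4 γ^A R C'`), the
energy-truncation error (`abs_blockComp_sub_energyTruncate_le`, N5d₁) and the time-separation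
error (`abs_blockComp_sub_sepBlockComp_le_of_budget`, N5d₃) — the BBGKY twin of
`abs_bgsrHierarchyFamily_sub_truncSepMain_le` for the Boltzmann hierarchy. Printed: Prop. 4.3
(4.14), Prop. 5.4, Prop. 5.5 for `f_N^{(1,K)}`, `f_{N,E}^{(1,K)}`, `f_{N,E,δ}^{(1,K)}`.
[cite: BodineauGallagherSaintRaymondInvent2016, §4.4 Prop. 4.3 and §5.3 Props. 5.4–5.5, pp. 13, 19–20] -/
theorem bgsrMarginal_ae_abs_sub_truncSepMain_le (hβ : 0 < β) (hρ₀m : Measurable ρ₀) {R : ℝ}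
    (hρ₀0 : ∀ x, 0 ≤ ρ₀ x) (hR : ∀ x, ρ₀ x ≤ R) (hN : (N : ℝ) * (2 * ε) ^ Fintype.card d ≤ 2⁻¹)
    {T : ℝ}
    (hS : ∀ s ≤ N + 1, ∀ t ∈ Icc 0 T,
      (hsHierarchyModel (d := d) hε hε' (N + 1)).seriesFamily (N + 1)
          (fun k => bgsrMarginalFamily hε hε' N β ρ₀ k 0) s t =ᵐ[volume]
        bgsrMarginalFamily hε hε' N β ρ₀ s t)
    (hRob : (hsHierarchyModel (d := d) hε hε' (N + 1)).RespectsAE (fun _ => volume))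
    {A : ℕ} (hA : 2 ≤ A) {γ : ℝ} (hγ0 : 0 ≤ γ) (hγ : γ ≤ 1 / 2) {h : ℝ} (hh0 : 0 ≤ h)
    (hsmall : max 1 (2 * maxwellianConst d β) * (hsHierarchyModel (d := d) hε hε' (N + 1)).pruneConst β * h ≤
      γ / exp 2)
    (K : ℕ) (hKT : K * h ≤ T) (E : ℝ) {δ : ℝ} (hδ : 0 ≤ δ) :
    ∀ᵐ Z : Config 1 d 𝕋, |bgsrMarginalFamily hε hε' N β ρ₀ 1 (K * h) Z -
        (hsHierarchyModel (d := d) hε hε' (N + 1)).sepBlockComp δ (pruneSeq A) h K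
          (energyTruncate E fun a => bgsrMarginalFamily hε hε' N β ρ₀ a 0) 1 Z| ≤
      4 * γ ^ A * R * max 1 (2 * maxwellianConst d β) +
        R * exp (-(β * E ^ 2 / 4)) * max 1 (2 * maxwellianConst d β) *
          exp (6 * (max 1 (2 * maxwellianConst d β) *
            (hsHierarchyModel (d := d) hε hε' (N + 1)).pruneConst (β / 2) * h) * (A : ℝ) ^ K) +
        12 * R * max 1 (2 * maxwellianConst d β) *
          (max 1 (2 * maxwellianConst d β) * (hsHierarchyModel (d := d) hε hε' (N + 1)).pruneConst β * δ) *
          (A : ℝ) ^ (2 * K) *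
          exp (12 * (max 1 (2 * maxwellianConst d β) *
            (hsHierarchyModel (d := d) hε hε' (N + 1)).pruneConst β * h) * (A : ℝ) ^ K) := by
  set M := hsHierarchyModel (d := d) hε hε' (N + 1) with hMdef
  set G0 : GCState d 𝕋 := fun a => bgsrMarginalFamily (d := d) hε hε' N β ρ₀ a 0 with hG0
  have hR0 : 0 ≤ R := (hρ₀0 0).trans (hR 0)
  have hC' : 1 ≤ max 1 (2 * maxwellianConst d β) := le_max_left _ _
  have hnice : ∀ k, IsNice (G0 k) := fun k =>
    ⟨measurable_bgsrMarginalFamily hε hε' N β ρ₀ hρ₀m k 0, R * (max 1 (2 * maxwellianConst d β)) ^ k, β, hβ,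
      abs_bgsrMarginalFamily_le hε hε' N β ρ₀ hβ hρ₀0 hR hN k 0⟩
  have hlev : IsLevelBdd G0 (pruneLevel A K) R (max 1 (2 * maxwellianConst d β)) β :=
    isLevelBdd_bgsrMarginalFamily_zero hε hε' N β ρ₀ hβ hρ₀0 hR hN _
  have h1 := bgsrMarginal_ae_abs_sub_blockComp_le hε hε' N β ρ₀ hβ hρ₀m hρ₀0 hR hN hS hRob hA hγ0 hγ
    hh0 hsmall K hKT
  filter_upwards [h1] with Z hZ
  have h2 := M.abs_blockComp_sub_energyTruncate_le hA hR0 hC' hβ hnice K hlev hh0 E Z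
  have hlevE : IsLevelBdd (energyTruncate E G0) (pruneLevel A K) R (max 1 (2 * maxwellianConst d β)) β :=
    fun a ha Z' => (abs_energyTruncate_le E G0 a Z').trans (hlev a ha Z')
  have h3 := M.abs_blockComp_sub_sepBlockComp_le_of_budget hδ hA hR0 hC' hβ
    (fun k => (hnice k).energyTruncate E) K hlevE hh0 Z
  calc _ = |(bgsrMarginalFamily hε hε' N β ρ₀ 1 (K * h) Z - M.blockComp (pruneSeq A) h K G0 1 Z) +
            (M.blockComp (pruneSeq A) h K G0 1 Z - M.blockComp (pruneSeq A) h K (energyTruncate E G0) 1 Z) +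
            (M.blockComp (pruneSeq A) h K (energyTruncate E G0) 1 Z -
              M.sepBlockComp δ (pruneSeq A) h K (energyTruncate E G0) 1 Z)| := by
          congr 1; ring
    _ ≤ _ := (abs_add_three _ _ _)
    _ ≤ _ := add_le_add (add_le_add hZ h2) h3

end Marginals

end Kinetic

end

end Literature.MathematicalPhysics.KineticTheory
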